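import Summits.QuantumFields.YangMills.Theorems.BalabanUVNodesN21LowCentreEndAtSUNBlockChartAnalytic
import Summits.QuantumFields.YangMills.Theorems.BalabanUVNodesN21LowCentreEndAtSUNBlockChartJacobianWitness

/-!
# N21 (NE7c) · THE [LF-II] §1-LETTERS END ON THE EXPONENTIAL `SU(N)` BLOCK CHART, VII: A6 WITNESS of ★ `cutChartLawAC_of_sect1Letters_analytic`
# — EVERY binder of the fully knitted cut-law END (Jacobian in the remainder, convexity from the rows + analyticity) discharged in the kernel

Width seat pub-ymgap-dag-n21-w1 (g2; director-ym №197 ∕ HUMAN RULING D-0149), node N21 = NE7c (NOT PRINTED in [Bałaban 1983–89], NOT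
proved), lane K3⁷ `SpineGivenEndpointR13SepCoPH` (stmt-QuantumFields-20544, `--kind proof --supports … --as helper`).  File 16 of the seat's
item-1 chain; companion of `…Analytic` (★ `cutChartLawAC_of_sect1Letters_analytic`) and `…JacobianWitness` (`neg_log_sinc_half_le`).
Director-ym STANDING A6 RULE №189 (3).  THEOREMS ONLY: 0 `def`, 0 `sorry`; count-neutral.

WHAT IS PROVED ([textbook]).
* ★ `cutChartLawAnalytic_binders_inhabited` — ONE CONCRETE BLOCK (lattice `Params.mk 1 3 0 0 …`, scale `0`, the bond `⟨default, 0⟩`), `N = 2`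
  (`d_2 = 3`), window `S = ½`, kept cuts `K₀ = ball 0 1` (so `diam K₀ < r := 3`), dressed exponent `A = ½Σ‖z b′‖²` presented as the MATRIX
  form `Q v = v̄ ⬝ᵥ (1 *ᵥ v̄)` in flat coordinates (`sum_sq_flatten`, p604008) with the (1.9) row at `γ₀ = 1, d = 1, M = 1∕100` on ALL vectors,
  linear member `ℓ = 0` ((1.6) at `B₃ = 1∕144`), third-order member `Vt = 0 = Re Φ`, `Φ = 0` (complex-differentiable, sup `S₂ = 0` on the
  `3`-balls; convexity clause `0 ≤ γ₀·3²`), statistic `‖z‖` (`L = 1`, `σ = 0`, `κ₀ = 1`), `C = univ`, `Env = {‖z‖ < 500}`, `Q = 0`, `θ = 500`,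
  `ρ = 1∕100` (so `D·ρ = 12∕0.99·(1∕100) < 1`: the concluded (M1) is NOT measure-trivial — ref-F READ-488 ADVISORY-1 on file 13), and the
  numeral's clause WITH the Haar Jacobian letter `W_J = −8 log sinc ½ ≤ 8∕23` (`neg_log_sinc_half_le`): EVERY binder of ★ holds.  A
  satisfiability witness of the binder list, not an estimate on Bałaban's measure.

HONEST FRAMING.  [textbook]; nothing of Bałaban's asserted; NE7c NOT PRINTED ∕ NOT proved; N21 NOT discharged; K3⁷ NOT claimed; counts
unmoved (typed 28∕28 · discharged 5∕27); never a count claim; one finite 𝕋⁴ at fixed ε — R4 would close only the conditional finite-𝕋⁴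
rung `BalabanLadder.UV`, NOT the Yang–Mills mass gap (Clay); nothing about ℝ⁴ ∕ OS.
-/

set_option autoImplicit false

noncomputable section

open MeasureTheory Set Function Finset Metric
open scoped ENNReal BigOperators Matrix

namespace Summit.QuantumFields.YangMills.Theorems.N21LowCentreEndAtSUNBlockChartAnalyticWitness

open Literature.MathematicalPhysics.QuantumFieldTheory.Balaban1983to89
open Literature.MathematicalPhysics.QuantumFieldTheory.Balaban1983to89.T4Continuum
open Literature.MathematicalPhysics.QuantumFieldTheory.Balaban1983to89.Node00 hiding dimSU
open Literature.MathematicalPhysics.QuantumFieldTheory.Balaban1983to89.T4ShellMeasure (SlotAntiConcentration)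
open Literature.MathematicalPhysics.QuantumFieldTheory.Balaban1983to89.B16Sect1Wilson (Ineq16 Ineq19)
open Summit.QuantumFields.BalabanUV.T4Continuum
open Summit.QuantumFields.BalabanUV.T4Continuum.ShellMeasureExpChartSUN (ChartSU BlockChartSU dimSU dimSU_eq chartWeightSU)
open Summit.QuantumFields.BalabanUV.T4Continuum.ShellMeasureExpJacobianSUN (expJacWeightSU)
open Summit.QuantumFields.BalabanUV.T4Continuum.ShellMeasureExpHaarAreaSUN (kappaSU)
open Summit.QuantumFields.BalabanUV.T4Continuum.ShellMeasureExpDuhamelSUN (duhT)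
open Summit.QuantumFields.YangMills.Theorems.N21LowCentreEndAtSUNBlockChart (sum_sq_flatten)
open Summit.QuantumFields.YangMills.Theorems.N21LowCentreEndAtSUNBlockChartRecord (convexOn_halfSumNormSq)
open Summit.QuantumFields.YangMills.Theorems.N21LowCentreEndAtSUNBlockChartJacobianWitness (neg_log_sinc_half_le)
open Summit.QuantumFields.YangMills.Theorems.N21LowCentreEndAtSUNBlockChartAnalytic (cutChartLawAC_of_sect1Letters_analytic)

/-- ★ **A6 WITNESS OF ★ `cutChartLawAC_of_sect1Letters_analytic`** (director-ym STANDING A6 RULE №189 (3)): at the concrete one-bond block,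
`N = 2`, `S = ½`, `K₀ = ball 0 1`, `r = 3`, `Φ = 0`, `(θ, ρ) = (500, 1∕100)` (`D·ρ < 1`, non-trivial (M1)): EVERY binder — the matrix quadratic member with (1.9) on all vectors, the linear member
with (1.6), the analyticity letter, the statistic, envelope, radial transversality, odds, and BOTH clauses (the numeral's WITH `W_J`, the
convexity's) — discharged in the kernel.  A satisfiability witness of the binder list, not an estimate on Bałaban's measure. [textbook] -/
theorem cutChartLawAnalytic_binders_inhabited :
    ∃ (P : Params) (j : ℕ) (b : Finset (PBond P j)), b.card = 1 ∧
      SlotAntiConcentration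
        (((volume : Measure (BlockChartSU 2 b)).withDensity fun z =>
            (ball (0 : BlockChartSU 2 b) 1 ∩ closedBall (0 : BlockChartSU 2 b) (1 / 2)).indicator
              (fun w => ENNReal.ofReal (Real.exp (-((∑ i, ‖w i‖ ^ 2) / 2 +
                (∑ i, -Real.log (LinearMap.det (duhT (w i) : ChartSU 2 →ₗ[ℝ] ChartSU 2))) -
                  b.card * Real.log (kappaSU 2).toReal)))) z).restrict
          ({z : BlockChartSU 2 b | ‖z‖ < 500} ∩ univ))
        (fun z : BlockChartSU 2 b => ‖z‖) 500 (1 / 100) (3 * ((b.card : ℝ) * dimSU 2 + 1) * (1 + 0) / (1 * (1 - 1 / 100))) := by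
  refine ⟨Params.mk 1 3 0 0 le_rfl ⟨⟨1, rfl⟩, Nat.one_lt_two.trans (Nat.lt_succ_self 2)⟩, 0, {⟨default, 0⟩},
    Finset.card_singleton _, ?_⟩
  set b : Finset (PBond (Params.mk 1 3 0 0 le_rfl ⟨⟨1, rfl⟩, Nat.one_lt_two.trans (Nat.lt_succ_self 2)⟩) 0) :=
    {⟨default, 0⟩} with hb_def
  have hb : b.Nonempty := Finset.singleton_nonempty _
  have hb1 : b.card = 1 := Finset.card_singleton _
  have hd2 : (dimSU 2 : ℝ) = 3 := by rw [dimSU_eq]; norm_num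
  -- measurability of the dressed presentation and of the statistic
  have hφc : Continuous fun w : BlockChartSU 2 b => (∑ i, ‖w i‖ ^ 2) / 2 :=
    (continuous_finsetSum _ fun i _ => ((continuous_apply i).norm).pow 2).div_const 2
  have hAm : Measurable fun z : BlockChartSU 2 b => (ball (0 : BlockChartSU 2 b) 1).indicator
      (fun w => ENNReal.ofReal (Real.exp (-((∑ i, ‖w i‖ ^ 2) / 2)))) z :=
    (ENNReal.measurable_ofReal.comp (Real.measurable_exp.comp hφc.measurable.neg)).indicator measurableSet_ball
  have hUm : Measurable fun z : BlockChartSU 2 b => ‖z‖ := measurable_norm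
  have hEnv : MeasurableSet {z : BlockChartSU 2 b | ‖z‖ < 500} := measurableSet_lt hUm measurable_const
  have hJ := neg_log_sinc_half_le
  -- the dressed exponent is convex on the whole space, a fortiori on the ball (only needed through ★'s own route)
  refine cutChartLawAC_of_sect1Letters_analytic (N := 2) le_rfl b hb (S := 1 / 2) (by norm_num)
    (by linarith [Real.pi_gt_three]) (ball (0 : BlockChartSU 2 b) 1) (fun w => (∑ i, ‖w i‖ ^ 2) / 2) (fun w => ∑ i, ‖w i‖ ^ 2)
    (fun _ => 0) (fun _ => 0) hAm hUm MeasurableSet.univ hEnv (Env := {z : BlockChartSU 2 b | ‖z‖ < 500}) (σ := 0) (κ₀ := 1)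
    (Q := 0) (L := 1) (γ₀ := 1) (M := 1 / 100) (B₃ := 1 / 144) (M₀ := 1) (A₀ := 1) (p₀g := 1) (Rk := 0) (WV := 0) (r := 3)
    (S₂ := 0) (d := 1)
    (by norm_num) (by norm_num) (by norm_num) (by norm_num) one_pos le_rfl one_pos le_rfl (by norm_num) one_pos ?_
    (convex_ball _ _) (mem_ball_self one_pos) ?_ 1 ?_ ?_ 0 (fun _ => (LinearMap.zero_apply _).symm) ?_ ?_ 0 ?_
    (fun _ _ => differentiableOn_const _) ?_ ?_ ?_ ?_ ?_ ?_ ?_ ?_ ?_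
  · -- hW
    simp
  · -- hexp: `A v = A 0 + ½·Q v + 0 + 0`
    intro v _
    show (∑ i, ‖v i‖ ^ 2) / 2 = (∑ i, ‖(0 : BlockChartSU 2 b) i‖ ^ 2) / 2 + 1 / 2 * (∑ i, ‖v i‖ ^ 2) + 0 + 0
    have h0 : (∑ i, ‖(0 : BlockChartSU 2 b) i‖ ^ 2) = 0 := by simp
    rw [h0]
    ring
  · -- hQf: `Σ‖v i‖² = v̄ ⬝ᵥ (1 *ᵥ v̄)` in flat coordinates
    intro v
    rw [Matrix.one_mulVec, dotProduct, ← sum_sq_flatten b v]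
    exact Finset.sum_congr rfl fun q _ => by ring
  · -- h19 (1.9) as a real inequality on all vectors: `½·Σ ≤ Σ`
    intro v
    have hS : 0 ≤ ∑ i, ‖v i‖ ^ 2 := Finset.sum_nonneg fun i _ => sq_nonneg _
    show (1 : ℝ) / (2 * ((1 : ℕ) : ℝ) * (100 * (1 / 100)) ^ (1 + 1)) * (∑ i, ‖v i‖ ^ 2) ≤ ∑ i, ‖v i‖ ^ 2
    calc (1 : ℝ) / (2 * ((1 : ℕ) : ℝ) * (100 * (1 / 100)) ^ (1 + 1)) * (∑ i, ‖v i‖ ^ 2)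
        = 1 / 2 * (∑ i, ‖v i‖ ^ 2) := by norm_num
      _ ≤ ∑ i, ‖v i‖ ^ 2 := by linarith
  · -- h16 (1.6): `|0| < 3·(1/144)·…`
    intro v _
    unfold Ineq16
    norm_num
  · -- hV
    intro v _
    simp
  · -- hVt: `0 = Re 0`
    intro x _
    simp
  · -- hΦS: `‖0‖ ≤ 0`
    intro x _ u _
    simp
  · -- hdiam: `diam (ball 0 1) < 3`
    intro x hx y hy
    rw [mem_ball_zero_iff] at hx hy
    calc ‖y - x‖ ≤ ‖y‖ + ‖x‖ := norm_sub_le _ _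
      _ < 3 := by linarith
  · -- the convexity clause: `16·1·1²·0 ≤ 1·3²`
    norm_num
  · -- hUL: the norm is 1-Lipschitz
    intro a a'
    rw [one_mul]
    exact (le_abs_self _).trans (abs_norm_sub_norm_le a a')
  · -- hUc
    simp
  · -- the numeral's clause, with `W_J = 1·(2·2)·(−2 log sinc ½) ≤ 8/23`
    rw [hb1, hd2]
    norm_num
    nlinarith [hJ]
  · -- henv: `‖l • z‖ = l‖z‖ < 500` for `l ∈ [l₀, 1]`
    intro l hl z _ h2 _
    rw [hb1] at hl
    have hl0 : 0 ≤ l := by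
      have hx : (0 : ℝ) ≤ (1 : ℕ) * (dimSU 2 : ℝ) := by positivity
      have : 1 / (((1 : ℕ) : ℝ) * dimSU 2 + 1) ≤ 1 := by
        rw [div_le_one (by positivity)]
        linarith
      linarith [hl.1]
    show ‖l • z‖ < 500
    rw [norm_smul, Real.norm_of_nonneg hl0]
    calc l * ‖z‖ ≤ 1 * ‖z‖ := mul_le_mul_of_nonneg_right hl.2 (norm_nonneg _)
      _ = ‖z‖ := one_mul _
      _ < 500 := h2
  · -- hRT: `‖s • z‖ = s‖z‖`
    intro z h1 _ _ s hs _ _ _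
    rw [norm_smul, Real.norm_of_nonneg (by linarith : (0 : ℝ) ≤ s)]
    nlinarith [mul_le_mul_of_nonneg_left h1 (show (0 : ℝ) ≤ s - 1 by linarith)]
  · -- hQ: the envelope IS the sub-level event (Q = 0)
    have hempty : {z : BlockChartSU 2 b | ‖z‖ < 500} \ ({z : BlockChartSU 2 b | ‖z‖ < 500} ∩ univ) = ∅ := by
      ext z
      simp
    rw [hempty, measure_empty]
    exact zero_le

end Summit.QuantumFields.YangMills.Theorems.N21LowCentreEndAtSUNBlockChartAnalyticWitness

end
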